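/-
search for candidate a priori estimates; no regularity claim

# K75a — THE DISCRIMINANT SHELL CUTOFF `σ_η = ρ_{η²} ∘ D` AND ITS GRADIENT LAW
# `|∇σ_η| ≤ η⁻² · 1_{η² ≤ D ≤ 3η²} · |∇D|`, `∫|∇σ_η| ≤ η⁻² ∫_{η² ≤ D ≤ 3η²} |∇D|` (nogo g56; door (e) box;
# infrastructure for the shell-content law (R21); imports only K73 `NoGo.TopEigHeatDiscCutoff`)

Node: Lemma L-λ(q) = `TopEigHeatCoercivePos q` (OPEN for every real `q > 1`); door (b)/(F2) wants
`¬ TopEigHeatCoercivePos q` (WANTED/OPEN). This file decides nothing about the node: it is calculus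
infrastructure. K73's canonical cutoff `χ_η = cutStep_{η²} ∘ D` of the simple set (`D = topDisc v =
(λ₁ − λ₂)(λ₁ − λ₃)`, zero exactly on the crossing set `{λ₂ = λ₁}`) has gradient
`η⁻² cutStep′(D/η²) ∇D` with the unnamed constant `sup |smoothTransition′|`, which is why K74's thinness
law (R20) leaves its perimeter term `∫|∇χ_η|` unevaluated. Here the profile is replaced by the RAMP STEP
`ρ_δ(s) := (G_δ(s) − G_δ(s − δ))/δ = δ⁻¹ ∫_{s−δ}^{s} g_δ` (`G_δ = cutRamp δ`, `g_δ = cutStep δ` of the tree's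
`TopEigCutoffRamp`), whose slope is controlled with constant ONE.
CONTENT (`v` smooth on `T³`, `η ≠ 0`, `|∇f| := √(Σₖ (∂ₖf)²)`, `K_η := {η² ≤ D ≤ 3η²}`):
§ 1 `rampStep δ`: `0 ≤ ρ_δ ≤ 1`, `ρ_δ = 0` on `(−∞, δ]`, `ρ_δ = 1` on `[3δ, ∞)`, smooth,
`ρ_δ′(s) = (g_δ(s) − g_δ(s − δ))/δ`, so `|ρ_δ′| ≤ δ⁻¹` everywhere and `ρ_δ′ = 0` on `(−∞, δ] ∪ [3δ, ∞)`.
§ 2 `discShell η v = ρ_{η²} ∘ D`: `0 ≤ σ_η ≤ 1`, `σ_η = 0` on `{D ≤ η²}` — hence near every crossing point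
(K72's cutoff hypothesis) — `σ_η = 1` on `{D ≥ 3η²}`, `Torus.IsSmooth`.
§ 3 CHAIN RULE AT EVERY POINT `∂ₖσ_η = ρ′(D) ∂ₖD` (at a crossing point both sides vanish) and the GRADIENT
LAW: `∂ₖσ_η = 0` on `{D ≤ η²} ∪ {D ≥ 3η²}`, `|∂ₖσ_η| ≤ η⁻²|∂ₖD|`, `|∇σ_η| ≤ η⁻² 1_{K_η} |∇D|` pointwise.
§ 4 `|∇D|` is continuous at every simple point, `K_η ⊂ U_s` is compact, so `|∇D|` is integrable on `K_η`
and **`integral_grad_discShell_le`: `∫|∇σ_η| ≤ η⁻² ∫_{K_η} |∇D|`** — the SHELL CONTENT of the design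
(by the co-area formula `∫_{K_η}|∇D| = ∫_{η²}^{3η²} Area{D = t} dt`, twice `η²` times the mean area of the
discriminant level surfaces in the shell; a remark, not formalised). Used by K75b for (R21). NOT CLAIMED:
any bound of the shell content by the heat; anything about L-λ(q); no number of record is touched.
[ours = this programme; folklore = one-variable calculus (FTC), chart calculus on `T^d`]
FILING (prove seat g32, REQUEST #104): declarations byte-identical to the no-go seat's staged `TopEigHeatDiscShell.STAGING.lean` 56ab8abae710895d; this line is the only addition.
-/
import Summits.NavierStokesRegularity.FunctionalMining.NoGo.TopEigHeatDiscCutoff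
import HarnessLib

noncomputable section

open Filter Topology Set MeasureTheory
open scoped ContDiff

namespace Summit.NavierStokesRegularity.FunctionalMining

open Literature.Analysis Literature.Analysis.FunctionSpaces Literature.Analysis.FunctionSpaces.Torus
open TopEig.DiscCutoff

namespace TopEig.DiscShell

/-! ## § 1 The ramp step `ρ_δ(s) = (G_δ(s) − G_δ(s − δ))/δ` -/

section Ramp

variable {δ s : ℝ}

/-- **The ramp step** `ρ_δ(s) := (G_δ(s) − G_δ(s − δ))/δ` (`G_δ = cutRamp δ`). [ours] -/
def rampStep (δ s : ℝ) : ℝ := (cutRamp δ s - cutRamp δ (s - δ)) / δ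

/-- `g_δ` is interval integrable (continuous). [folklore] -/
private theorem cutStep_intervalIntegrable (δ a b : ℝ) : IntervalIntegrable (cutStep δ) volume a b :=
  (continuous_cutStep δ).intervalIntegrable a b

/-- `G_δ(s) − G_δ(t) = ∫_t^s g_δ`. [folklore] -/
theorem cutRamp_sub_cutRamp (δ s t : ℝ) : cutRamp δ s - cutRamp δ t = ∫ r in t..s, cutStep δ r :=
  intervalIntegral.integral_interval_sub_left (cutStep_intervalIntegrable δ 0 s)
    (cutStep_intervalIntegrable δ 0 t)

/-- `ρ_δ(s) = δ⁻¹ ∫_{s−δ}^{s} g_δ`. [folklore] -/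
theorem rampStep_eq (δ s : ℝ) : rampStep δ s = (∫ r in (s - δ)..s, cutStep δ r) / δ := by
  rw [rampStep, cutRamp_sub_cutRamp]

/-- `0 ≤ ∫_{s−δ}^{s} g_δ` (`δ ≥ 0`). [folklore] -/
theorem intervalIntegral_cutStep_nonneg (hδ : 0 ≤ δ) : 0 ≤ ∫ r in (s - δ)..s, cutStep δ r :=
  intervalIntegral.integral_nonneg (by linarith) fun r _ => cutStep_nonneg δ r

/-- `∫_{s−δ}^{s} g_δ ≤ δ` (`δ ≥ 0`; `g_δ ≤ 1`). [folklore] -/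
theorem intervalIntegral_cutStep_le (hδ : 0 ≤ δ) : ∫ r in (s - δ)..s, cutStep δ r ≤ δ := by
  have h := intervalIntegral.integral_mono_on (by linarith : s - δ ≤ s)
    (cutStep_intervalIntegrable δ _ _) (intervalIntegrable_const (μ := volume) (c := (1 : ℝ)))
    fun r _ => cutStep_le_one δ r
  rwa [intervalIntegral.integral_const, smul_eq_mul, mul_one, sub_sub_cancel] at h

/-- `0 ≤ ρ_δ` (`δ ≥ 0`). [ours, bookkeeping] -/
theorem rampStep_nonneg (hδ : 0 ≤ δ) : 0 ≤ rampStep δ s := by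
  rw [rampStep_eq]
  exact div_nonneg (intervalIntegral_cutStep_nonneg hδ) hδ

/-- `ρ_δ ≤ 1` (`δ ≥ 0`). [ours, bookkeeping] -/
theorem rampStep_le_one (hδ : 0 ≤ δ) : rampStep δ s ≤ 1 := by
  rw [rampStep_eq]
  exact div_le_one_of_le₀ (intervalIntegral_cutStep_le hδ) hδ

/-- `ρ_δ(s) = 0` for `s ≤ δ` (`δ > 0`): both ramps vanish. [ours, bookkeeping] -/
theorem rampStep_of_le (hδ : 0 < δ) (hs : s ≤ δ) : rampStep δ s = 0 := by
  rw [rampStep, cutRamp_of_le hδ hs, cutRamp_of_le hδ (by linarith), sub_zero, zero_div]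

/-- `ρ_δ(s) = 1` for `3δ ≤ s` (`δ > 0`): `g_δ = 1` on `[s − δ, s] ⊂ [2δ, ∞)`. [ours, bookkeeping] -/
theorem rampStep_of_ge (hδ : 0 < δ) (hs : 3 * δ ≤ s) : rampStep δ s = 1 := by
  rw [rampStep_eq, intervalIntegral.integral_congr (g := fun _ => (1 : ℝ)) fun r hr => ?_,
    intervalIntegral.integral_const, smul_eq_mul, mul_one, sub_sub_cancel, div_self hδ.ne']
  rw [uIcc_of_le (by linarith)] at hr
  exact cutStep_of_ge hδ (by linarith [hr.1])

/-- **`ρ_δ′(s) = (g_δ(s) − g_δ(s − δ))/δ`** (FTC: `G_δ′ = g_δ`). [folklore] -/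
theorem hasDerivAt_rampStep (δ s : ℝ) :
    HasDerivAt (rampStep δ) ((cutStep δ s - cutStep δ (s - δ)) / δ) s := by
  have h2 : HasDerivAt (fun t => cutRamp δ (t - δ)) (cutStep δ (s - δ)) s :=
    HasDerivAt.comp_sub_const s δ (hasDerivAt_cutRamp δ (s - δ))
  show HasDerivAt (fun t => (cutRamp δ t - cutRamp δ (t - δ)) / δ) _ s
  exact ((hasDerivAt_cutRamp δ s).sub h2).div_const δ

/-- `deriv ρ_δ = (g_δ − g_δ(· − δ))/δ`. [folklore] -/
theorem deriv_rampStep (δ s : ℝ) : deriv (rampStep δ) s = (cutStep δ s - cutStep δ (s - δ)) / δ :=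
  (hasDerivAt_rampStep δ s).deriv

/-- `ρ_δ` is differentiable. [folklore] -/
theorem differentiable_rampStep (δ : ℝ) : Differentiable ℝ (rampStep δ) := fun s =>
  (hasDerivAt_rampStep δ s).differentiableAt

/-- `ρ_δ` is smooth. [folklore] -/
theorem contDiff_rampStep (δ : ℝ) : ContDiff ℝ ∞ (rampStep δ) := by
  show ContDiff ℝ ∞ fun t => (cutRamp δ t - cutRamp δ (t - δ)) / δ
  exact ((contDiff_cutRamp δ).sub ((contDiff_cutRamp δ).comp (contDiff_id.sub contDiff_const))).div_const δ

/-- **`|ρ_δ′| ≤ δ⁻¹` everywhere** (`δ > 0`; `g_δ ∈ [0, 1]`): the slope constant is ONE. [ours] -/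
theorem abs_deriv_rampStep_le (hδ : 0 < δ) (s : ℝ) : |deriv (rampStep δ) s| ≤ δ⁻¹ := by
  rw [deriv_rampStep, abs_div, abs_of_pos hδ, div_le_iff₀ hδ, inv_mul_cancel₀ hδ.ne']
  have h1 := cutStep_nonneg δ s
  have h2 := cutStep_le_one δ s
  have h3 := cutStep_nonneg δ (s - δ)
  have h4 := cutStep_le_one δ (s - δ)
  exact abs_le.2 ⟨by linarith, by linarith⟩

/-- `ρ_δ′(s) = 0` for `s ≤ δ` (`δ > 0`). [ours, bookkeeping] -/
theorem deriv_rampStep_of_le (hδ : 0 < δ) (hs : s ≤ δ) : deriv (rampStep δ) s = 0 := by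
  rw [deriv_rampStep, cutStep_of_le hδ hs, cutStep_of_le hδ (by linarith), sub_zero, zero_div]

/-- `ρ_δ′(s) = 0` for `3δ ≤ s` (`δ > 0`). [ours, bookkeeping] -/
theorem deriv_rampStep_of_ge (hδ : 0 < δ) (hs : 3 * δ ≤ s) : deriv (rampStep δ) s = 0 := by
  rw [deriv_rampStep, cutStep_of_ge hδ (by linarith), cutStep_of_ge hδ (by linarith), sub_self, zero_div]

end Ramp

/-! ## § 2 The shell cutoff `σ_η = ρ_{η²} ∘ D` on `T³` -/

section Three

variable {v : UnitAddTorus (Fin 3) → EuclideanSpace ℝ (Fin 3)} {η : ℝ} {x : UnitAddTorus (Fin 3)}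

/-- **The shell cutoff** `σ_η(x) := ρ_{η²}(D(x))`: `0` where `D ≤ η²`, `1` where `D ≥ 3η²`. [ours] -/
def discShell (η : ℝ) (v : UnitAddTorus (Fin 3) → EuclideanSpace ℝ (Fin 3)) (x : UnitAddTorus (Fin 3)) : ℝ :=
  rampStep (η ^ 2) (topDisc v x)

/-- `0 ≤ σ_η`. [ours, bookkeeping] -/
theorem discShell_nonneg : 0 ≤ discShell η v x := rampStep_nonneg (sq_nonneg η)

/-- `σ_η ≤ 1`. [ours, bookkeeping] -/
theorem discShell_le_one : discShell η v x ≤ 1 := rampStep_le_one (sq_nonneg η)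

/-- `σ_η = 0` on `{D ≤ η²}`. [ours] -/
theorem discShell_eq_zero (hη : η ≠ 0) (h : topDisc v x ≤ η ^ 2) : discShell η v x = 0 :=
  rampStep_of_le (by positivity) h

/-- `σ_η = 1` on `{3η² ≤ D}`. [ours] -/
theorem discShell_eq_one (hη : η ≠ 0) (h : 3 * η ^ 2 ≤ topDisc v x) : discShell η v x = 1 :=
  rampStep_of_ge (by positivity) h

/-- The support of `σ_η` lies in `{η² < D}` (inside `U_s`). [ours] -/
theorem sq_lt_topDisc_of_discShell_ne_zero (hη : η ≠ 0) (h : discShell η v x ≠ 0) : η ^ 2 < topDisc v x :=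
  not_le.1 fun hle => h (discShell_eq_zero hη hle)

/-- **`σ_η` vanishes near every point of the crossing set** (K72's cutoff hypothesis): `D` is continuous
and `D = 0 < η²` there. [ours] -/
theorem discShell_eventuallyEq_zero (hv : Torus.IsSmooth v) (hη : η ≠ 0)
    (hx : ¬ torusStrainMidEig v x < torusStrainTopEig v x) : discShell η v =ᶠ[𝓝 x] fun _ => 0 := by
  have h0 : topDisc v x = 0 := topDisc_eq_zero_of_not_lt hx
  have hlt : ∀ᶠ y in 𝓝 x, topDisc v y < η ^ 2 :=
    (continuous_topDisc hv).continuousAt.eventually_lt continuousAt_const (by rw [h0]; positivity)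
  filter_upwards [hlt] with y hy
  exact discShell_eq_zero hη hy.le

/-- **`σ_η` is smooth on `T³`**: a smooth function of the chart-smooth `D` on `U_s`, identically `0` near
every point of the crossing set. [ours] -/
theorem isSmooth_discShell (hv : Torus.IsSmooth v) (hη : η ≠ 0) : Torus.IsSmooth (discShell η v) := by
  unfold Torus.IsSmooth
  rw [← liftAt_zero_left]
  refine contDiff_iff_contDiffAt.2 fun w => ?_
  by_cases hx : torusStrainMidEig v ((0 : UnitAddTorus (Fin 3)) + proj w) <
      torusStrainTopEig v ((0 : UnitAddTorus (Fin 3)) + proj w)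
  · have h1 : ContDiffAt ℝ ∞ (liftAt (topDisc v) 0) w :=
      contDiffAt_liftAt_of_shift (contDiffAt_liftAt_topDisc hv hx)
    have hfun : liftAt (discShell η v) 0 = rampStep (η ^ 2) ∘ liftAt (topDisc v) 0 := rfl
    rw [hfun]
    exact (contDiff_rampStep _).contDiffAt.comp w h1
  · have ht : Tendsto (fun w' : EuclideanSpace ℝ (Fin 3) => (0 : UnitAddTorus (Fin 3)) + proj w') (𝓝 w)
        (𝓝 ((0 : UnitAddTorus (Fin 3)) + proj w)) := (continuous_const.add continuous_proj).continuousAt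
    have hEq : liftAt (discShell η v) 0 =ᶠ[𝓝 w] fun _ => (0 : ℝ) := by
      filter_upwards [ht.eventually (discShell_eventuallyEq_zero hv hη hx)] with w' hw'
      simpa only [liftAt_apply] using hw'
    exact contDiffAt_const.congr_of_eventuallyEq hEq

/-! ## § 3 Chain rule at every point and the gradient law -/

/-- **Local chain rule on `T^d`**: `∂ₖ(φ ∘ f)(x) = φ′(f x) ∂ₖf(x)` when the chart `liftAt f x` is `C^∞` at
`0` and `φ` has derivative `φ′` at `f x`. [folklore] -/
theorem partialDeriv_comp_of_contDiffAt_liftAt {d : Type*} [Fintype d] [DecidableEq d] {φ : ℝ → ℝ}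
    {φ' : ℝ} {f : UnitAddTorus d → ℝ} {x : UnitAddTorus d} (hφ : HasDerivAt φ φ' (f x))
    (hf : ContDiffAt ℝ ∞ (liftAt f x) 0) (k : d) :
    Torus.partialDeriv k (fun y => φ (f y)) x = φ' * Torus.partialDeriv k f x := by
  have h := hφ.comp_of_eq (0 : ℝ) (hasDerivAt_coordLine_of_contDiffAt hf k)
    (by simp only [zero_smul, proj_zero, add_zero])
  exact h.deriv

/-- **CHAIN RULE FOR `σ_η` AT EVERY POINT: `∂ₖσ_η(x) = ρ_{η²}′(D x) · ∂ₖD(x)`** — on `U_s` by the local chain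
rule (`D` is chart-smooth there, K73); at a crossing point the left side vanishes (`σ_η = 0` nearby) and
so does the right side (`D = 0`, `ρ′(0) = 0`). [ours] -/
theorem partialDeriv_discShell (hv : Torus.IsSmooth v) (hη : η ≠ 0) (k : Fin 3) (x : UnitAddTorus (Fin 3)) :
    Torus.partialDeriv k (discShell η v) x =
      deriv (rampStep (η ^ 2)) (topDisc v x) * Torus.partialDeriv k (topDisc v) x := by
  by_cases hx : torusStrainMidEig v x < torusStrainTopEig v x
  · exact partialDeriv_comp_of_contDiffAt_liftAt (φ := rampStep (η ^ 2)) (f := topDisc v)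
      (differentiable_rampStep _ _).hasDerivAt (contDiffAt_liftAt_topDisc hv hx) k
  · rw [partialDeriv_eq_zero_of_eventuallyEq (discShell_eventuallyEq_zero hv hη hx) k,
      topDisc_eq_zero_of_not_lt hx, deriv_rampStep_of_le (by positivity) (by positivity), zero_mul]

/-- `∂ₖσ_η = 0` on `{D ≤ η²}`. [ours] -/
theorem partialDeriv_discShell_eq_zero_of_le (hv : Torus.IsSmooth v) (hη : η ≠ 0) (h : topDisc v x ≤ η ^ 2)
    (k : Fin 3) : Torus.partialDeriv k (discShell η v) x = 0 := by
  rw [partialDeriv_discShell hv hη k x, deriv_rampStep_of_le (by positivity) h, zero_mul]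

/-- `∂ₖσ_η = 0` on `{D ≥ 3η²}`. [ours] -/
theorem partialDeriv_discShell_eq_zero_of_ge (hv : Torus.IsSmooth v) (hη : η ≠ 0)
    (h : 3 * η ^ 2 ≤ topDisc v x) (k : Fin 3) : Torus.partialDeriv k (discShell η v) x = 0 := by
  rw [partialDeriv_discShell hv hη k x, deriv_rampStep_of_ge (by positivity) h, zero_mul]

/-- **`|∂ₖσ_η| ≤ η⁻² |∂ₖD|` at every point.** [ours] -/
theorem abs_partialDeriv_discShell_le (hv : Torus.IsSmooth v) (hη : η ≠ 0) (k : Fin 3)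
    (x : UnitAddTorus (Fin 3)) :
    |Torus.partialDeriv k (discShell η v) x| ≤ (η ^ 2)⁻¹ * |Torus.partialDeriv k (topDisc v) x| := by
  rw [partialDeriv_discShell hv hη k x, abs_mul]
  exact mul_le_mul_of_nonneg_right (abs_deriv_rampStep_le (by positivity) _) (abs_nonneg _)

/-- **`|∇σ_η| ≤ η⁻² |∇D|` at every point** (`|∇f| = √(Σₖ (∂ₖf)²)`). [ours] -/
theorem sqrt_sum_sq_partialDeriv_discShell_le (hv : Torus.IsSmooth v) (hη : η ≠ 0)
    (x : UnitAddTorus (Fin 3)) :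
    Real.sqrt (∑ k, Torus.partialDeriv k (discShell η v) x ^ 2) ≤
      (η ^ 2)⁻¹ * Real.sqrt (∑ k, Torus.partialDeriv k (topDisc v) x ^ 2) := by
  have hi : 0 ≤ (η ^ 2)⁻¹ := inv_nonneg.2 (sq_nonneg η)
  have hk : ∀ k, Torus.partialDeriv k (discShell η v) x ^ 2 ≤
      ((η ^ 2)⁻¹ * Torus.partialDeriv k (topDisc v) x) ^ 2 := fun k =>
    sq_le_sq.2 (by
      rw [abs_mul ((η ^ 2)⁻¹), abs_of_nonneg hi]
      exact abs_partialDeriv_discShell_le hv hη k x)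
  calc Real.sqrt (∑ k, Torus.partialDeriv k (discShell η v) x ^ 2)
      ≤ Real.sqrt (∑ k, ((η ^ 2)⁻¹ * Torus.partialDeriv k (topDisc v) x) ^ 2) :=
        Real.sqrt_le_sqrt (Finset.sum_le_sum fun k _ => hk k)
    _ = Real.sqrt (((η ^ 2)⁻¹) ^ 2 * ∑ k, Torus.partialDeriv k (topDisc v) x ^ 2) := by
        rw [Finset.mul_sum]
        simp only [mul_pow]
    _ = (η ^ 2)⁻¹ * Real.sqrt (∑ k, Torus.partialDeriv k (topDisc v) x ^ 2) := by
        rw [Real.sqrt_mul (sq_nonneg _), Real.sqrt_sq hi]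

/-- **THE GRADIENT LAW (pointwise): `|∇σ_η| ≤ η⁻² · 1_{K_η} · |∇D|`**, `K_η = {η² ≤ D ≤ 3η²}` (off `K_η` every
`∂ₖσ_η` vanishes). [ours] -/
theorem sqrt_sum_sq_partialDeriv_discShell_le_indicator (hv : Torus.IsSmooth v) (hη : η ≠ 0)
    (x : UnitAddTorus (Fin 3)) :
    Real.sqrt (∑ k, Torus.partialDeriv k (discShell η v) x ^ 2) ≤
      (η ^ 2)⁻¹ * Set.indicator {x | η ^ 2 ≤ topDisc v x ∧ topDisc v x ≤ 3 * η ^ 2}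
        (fun x => Real.sqrt (∑ k, Torus.partialDeriv k (topDisc v) x ^ 2)) x := by
  by_cases hx : x ∈ {x | η ^ 2 ≤ topDisc v x ∧ topDisc v x ≤ 3 * η ^ 2}
  · rw [Set.indicator_of_mem hx]
    exact sqrt_sum_sq_partialDeriv_discShell_le hv hη x
  · rw [Set.indicator_of_notMem hx, mul_zero]
    have h0 : ∀ k, Torus.partialDeriv k (discShell η v) x = 0 := fun k => by
      simp only [Set.mem_setOf_eq, not_and_or, not_le] at hx
      rcases hx with h | h
      · exact partialDeriv_discShell_eq_zero_of_le hv hη h.le k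
      · exact partialDeriv_discShell_eq_zero_of_ge hv hη h.le k
    simp [h0]

/-! ## § 4 The shell content `∫_{K_η} |∇D|` and the integrated gradient law -/

/-- Continuity at `x` from continuity of the chart `liftAt g x` at `0` (`proj` is an open quotient map); a
private copy of K70's lemma, so that this file imports the tree only. [folklore] -/
private theorem continuousAt_of_continuousAt_liftAt {d : Type*} {g : UnitAddTorus d → ℝ} {x : UnitAddTorus d}
    (h : ContinuousAt (liftAt g x) 0) : ContinuousAt g x := by
  rw [ContinuousAt] at h ⊢
  rw [liftAt_apply_zero] at h
  refine tendsto_def.2 fun s hs => ?_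
  have h' : ∀ᶠ w in 𝓝 (0 : EuclideanSpace ℝ d), g (x + proj w) ∈ s := by
    filter_upwards [h.eventually_mem hs] with w hw
    rwa [liftAt_apply] at hw
  exact eventually_nhds_of_chart h'

/-- `∂ₖD` is continuous at every simple point (chart smoothness of `D`, K73). [ours, bookkeeping] -/
theorem continuousAt_partialDeriv_topDisc (hv : Torus.IsSmooth v)
    (hx : torusStrainMidEig v x < torusStrainTopEig v x) (k : Fin 3) :
    ContinuousAt (Torus.partialDeriv k (topDisc v)) x :=
  continuousAt_of_continuousAt_liftAt
    (contDiffAt_liftAt_partialDeriv (contDiffAt_liftAt_topDisc hv hx) k).1.continuousAt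

/-- The shell `K_η = {η² ≤ D ≤ 3η²}` is compact. [ours, bookkeeping] -/
theorem isCompact_discShellSet (hv : Torus.IsSmooth v) :
    IsCompact {x | η ^ 2 ≤ topDisc v x ∧ topDisc v x ≤ 3 * η ^ 2} := by
  rw [Set.setOf_and]
  exact ((isClosed_le continuous_const (continuous_topDisc hv)).inter
    (isClosed_le (continuous_topDisc hv) continuous_const)).isCompact

/-- `|∇D|` is continuous on the shell `K_η` (`η ≠ 0`: `K_η ⊂ U_s`). [ours, bookkeeping] -/
theorem continuousOn_grad_topDisc_shell (hv : Torus.IsSmooth v) (hη : η ≠ 0) :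
    ContinuousOn (fun x => Real.sqrt (∑ k, Torus.partialDeriv k (topDisc v) x ^ 2))
      {x | η ^ 2 ≤ topDisc v x ∧ topDisc v x ≤ 3 * η ^ 2} := fun x hx => by
  have hxs : torusStrainMidEig v x < torusStrainTopEig v x :=
    topDisc_pos_iff.1 (lt_of_lt_of_le (by positivity) hx.1)
  have h : ContinuousAt (fun x => ∑ k, Torus.partialDeriv k (topDisc v) x ^ 2) x :=
    tendsto_finsetSum _ fun k _ => ((continuousAt_partialDeriv_topDisc hv hxs k).pow 2).tendsto
  exact h.sqrt.continuousWithinAt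

/-- **`|∇D|` is integrable on the shell `K_η`** (continuous on a compact set). [ours, bookkeeping] -/
theorem integrableOn_grad_topDisc_shell (hv : Torus.IsSmooth v) (hη : η ≠ 0) :
    IntegrableOn (fun x => Real.sqrt (∑ k, Torus.partialDeriv k (topDisc v) x ^ 2))
      {x | η ^ 2 ≤ topDisc v x ∧ topDisc v x ≤ 3 * η ^ 2} volume :=
  (continuousOn_grad_topDisc_shell hv hη).integrableOn_compact (isCompact_discShellSet hv)

/-- **THE INTEGRATED GRADIENT LAW `∫|∇σ_η| ≤ η⁻² ∫_{K_η} |∇D|`** (`v` smooth on `T³`, `η ≠ 0`): the total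
variation of the shell cutoff is at most `η⁻²` times the SHELL CONTENT of the design. [ours] -/
theorem integral_grad_discShell_le (hv : Torus.IsSmooth v) (hη : η ≠ 0) :
    ∫ x, Real.sqrt (∑ k, Torus.partialDeriv k (discShell η v) x ^ 2) ≤
      (η ^ 2)⁻¹ * ∫ x in {x | η ^ 2 ≤ topDisc v x ∧ topDisc v x ≤ 3 * η ^ 2},
        Real.sqrt (∑ k, Torus.partialDeriv k (topDisc v) x ^ 2) := by
  have hS : MeasurableSet {x | η ^ 2 ≤ topDisc v x ∧ topDisc v x ≤ 3 * η ^ 2} :=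
    (isCompact_discShellSet hv).isClosed.measurableSet
  rw [← integral_indicator hS, ← integral_const_mul]
  exact integral_mono_of_nonneg (Eventually.of_forall fun x => Real.sqrt_nonneg _)
    (((integrableOn_grad_topDisc_shell hv hη).integrable_indicator hS).const_mul _)
    (Eventually.of_forall fun x => sqrt_sum_sq_partialDeriv_discShell_le_indicator hv hη x)

end Three

end TopEig.DiscShell

end Summit.NavierStokesRegularity.FunctionalMining

end
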